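import Summits.FinalStateConjecture.FinalStateConjecture.Theses.LaminatedThreshold
import Summits.FinalStateConjecture.FinalStateConjecture.Theorems.LaminatedThresholdCombLemmaAdapted
import Summits.FinalStateConjecture.FinalStateConjecture.Theorems.ClusterCompletenessOmegaLimitMultiKerrT2Defs

/-!
# Crux `LaminatedThreshold` · line `heteroclinic_comb` as a ONE-STUB line — the not-settled / sojourn carrier

Support file for crux item stmt-FinalStateConjecture-16893 (route LaminatedThreshold, crux A), prover seat 0,
2026-08-17 (session 7). State of the line: the adapted comb lemma `Comb.comb_lemma_adapted` is LANDED
(seat 1, `LaminatedThresholdCombLemmaAdapted.lean`), so the re-typed line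
(`laminatedThreshold_of_adaptedComb`, `LaminatedThresholdAdaptedCombReduction.lean`) reads
  adapted vacuum comb carrier (nakedness dictionary: a VISIBLE INCOMPLETE NULL RAY in every MGHD)
  ∧ `stub_nakedNotSettled` (visible incomplete null ray ⇒ not settled-T2) ⇒ `LaminatedThreshold`.
`stub_nakedNotSettled` is honest but XL: it quantifies over EVERY maximal vacuum development of EVERY
admissible datum, and neither of its two conceivable proofs is available from the typed clauses by soft
causal theory — (a) "a future-endless null geodesic confined to `closure O` under exhaustive `C²`-settling
charts is future complete" needs a RATE of convergence integrable in chart time (the typed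
`HasExhaustiveCharts` / deviation `→ 0` carries none, and the Grönwall bound on the blueshift factor
`ẋ⁰ ≲ exp ∫ sup_slab |Γ - Γ_background|` does not close without one), (b) "visible incomplete ray ⇒ far
inward normalised rays are cut with bounded sojourn" is the causal-boundary (Cauchy-horizon) analysis of
the MGHD plus far-field asymptotics.

This file removes Stub 3 altogether by moving the nakedness dictionary of the carrier to the form the
summit statement itself uses: the carrier's coded members have, in every MGHD, NOT (complete sojourn-`𝓘⁺`
∧ settled-T2) — `laminatedThreshold_of_notSettledCarrier` — or, as the physics would deliver it, INCOMPLETE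
future null infinity in Christodoulou's sojourn sense (`¬ HasCompleteNullInfinity`; the sojourn rendering
was designed to fail on naked-singularity MGHDs, `NullInfinity.lean`, test table) —
`laminatedThreshold_of_sojournCarrier`. With either carrier the crux follows BY NAME from ONE physics stub,
the abstract comb lemma being discharged by `Comb.comb_lemma_adapted`; the carrier's other clauses
(admissible `d⋆`, `C¹` adapted period map `T` with `DT(0) = S ⊕ μ`, `‖S‖ < 1 < μ`, `t`-axis invariant,
continuity of `π` along local admissible families, two-sided transverse `C¹` seeds at every scale) are
VERBATIM those of the registered adapted carrier. No new definitions; hypotheses inlined.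
-/

-- every `Summit.FinalStateConjecture.FinalStateConjecture.…` name repeats the summit = sub-problem segment (D-0017 layout)
set_option linter.dupNamespace false

noncomputable section

open Set Filter Metric Function Topology
open scoped Manifold ContDiff
open Literature.Geometry.Lorentzian
open Summit.FinalStateConjecture.FinalStateConjecture.Theses.LaminatedThreshold
open Summit.FinalStateConjecture.FinalStateConjecture.Theorems.ClusterCompleteness (SettlesT2)

namespace Summit.FinalStateConjecture.FinalStateConjecture.Theorems.LaminatedThreshold

/-- **Crux A from ONE stub: the adapted vacuum comb carrier with the not-settled dictionary.**
If there are an admissible datum `d⋆`, a Banach space `E`, a `C¹` period map `T` near `0 ∈ E × ℝ` with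
`T 0 = 0`, `DT(0) = S ⊕ μ`, `‖S‖ < 1 < μ`, the `t`-axis `T`-invariant near `0`, a coordinate map `π` on data
with `π d⋆ = 0` continuous along every jointly smooth admissible local family through `d⋆`, and, at every
scale `r > 0`, transverse `C¹` seeds `G₁ = 0`, `G₂ = 0` through `(0, σ₁)`, `(0, σ₂)`, `0 < σ₁ < r`,
`-r < σ₂ < 0`, with a tolerance `ε₂ > 0` such that along every such family the members `F c`, `c` small,
whose `π`-orbit under `T` either stays `ε₂`-close to `0` for ever or meets a seed `ε₂`-close to its anchor
have NO maximal vacuum development that is settled-T2 (complete sojourn-`𝓘⁺` and a sub-extremal, ray-closed,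
exhaustive, future-oriented Kerr decomposition) — then `LaminatedThreshold` holds, with functional `Φ ∘ π`
and code set `K` supplied by the adapted comb lemma `Comb.comb_lemma_adapted` at the carrier's scale.
[cite: GrebogiEtAl1983] [cite: McdonaldEtAl1985] -/
theorem laminatedThreshold_of_notSettledCarrier : (∃ (X : Type) (_ : TopologicalSpace X) (_ : ChartedSpace Literature.Geometry.Lorentzian.E3 X) (_ : IsManifold (𝓡 3) ((⊤ : ℕ∞) : WithTop ℕ∞) X) (_ : T2Space X) (_ : SecondCountableTopology X) (_ : ConnectedSpace X) (dstar : Literature.Geometry.Lorentzian.InitialDataSet (𝓡 3) X) (E : Type) (_ : NormedAddCommGroup E) (_ : NormedSpace ℝ E) (_ : CompleteSpace E) (T : E × ℝ → E × ℝ) (S : E →L[ℝ] E) (μ r₀ : ℝ) (π : Literature.Geometry.Lorentzian.InitialDataSet (𝓡 3) X → E × ℝ), dstar ∈ Literature.Geometry.Lorentzian.admissibleVacuumData X ∧ T 0 = 0 ∧ 0 < r₀ ∧ ContDiffOn ℝ 1 T (Metric.ball 0 r₀) ∧ HasFDerivAt T ((S.comp (ContinuousLinearMap.fst ℝ E ℝ)).prod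 (μ • ContinuousLinearMap.snd ℝ E ℝ)) 0 ∧ ‖S‖ < 1 ∧ 1 < μ ∧ (∀ t : ℝ, |t| < r₀ → (T ((0 : E), t)).1 = 0) ∧ π dstar = 0 ∧ (∀ F : EuclideanSpace ℝ (Fin 1) → Literature.Geometry.Lorentzian.InitialDataSet (𝓡 3) X, Literature.Geometry.Lorentzian.InitialDataSet.IsSmoothDataFamily 1 F → F 0 = dstar → (∀ c, F c ∈ Literature.Geometry.Lorentzian.admissibleVacuumData X) → (∃ C : Set X, IsCompact C ∧ ∀ c, ∀ x ∉ C, (F c).h.inner x = dstar.h.inner x ∧ (F c).k x = dstar.k x) → ∃ δ : ℝ, 0 < δ ∧ ContinuousOn (fun c ↦ π (F c)) (Metric.ball 0 δ)) ∧ ∀ r : ℝ, 0 < r → ∃ (σ₁ σ₂ ε₂ : ℝ) (G₁ G₂ : E × ℝ → ℝ), 0 < ε₂ ∧ (0 < σ₁ ∧ σ₁ < r ∧ -r < σ₂ ∧ σ₂ < 0 ∧ (∃ r' : ℝ, 0 < r' ∧ ContDiffOn ℝ 1 G₁ (Metric.ball ((0 : E), σ₁) r') ∧ ContDiffOn ℝ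 1 G₂ (Metric.ball ((0 : E), σ₂) r')) ∧ G₁ ((0 : E), σ₁) = 0 ∧ fderiv ℝ G₁ ((0 : E), σ₁) ((0 : E), (1 : ℝ)) ≠ 0 ∧ G₂ ((0 : E), σ₂) = 0 ∧ fderiv ℝ G₂ ((0 : E), σ₂) ((0 : E), (1 : ℝ)) ≠ 0) ∧ ∀ F : EuclideanSpace ℝ (Fin 1) → Literature.Geometry.Lorentzian.InitialDataSet (𝓡 3) X, Literature.Geometry.Lorentzian.InitialDataSet.IsSmoothDataFamily 1 F → F 0 = dstar → (∀ c, F c ∈ Literature.Geometry.Lorentzian.admissibleVacuumData X) → (∃ C : Set X, IsCompact C ∧ ∀ c, ∀ x ∉ C, (F c).h.inner x = dstar.h.inner x ∧ (F c).k x = dstar.k x) → ∃ δ : ℝ, 0 < δ ∧ ∀ c ∈ Metric.ball (0 : EuclideanSpace ℝ (Fin 1)) δ, ((∀ n : ℕ, T^[n] (π (F c)) ∈ Metric.ball (0 : E × ℝ) ε₂) ∨ (∃ n : ℕ, T^[n] (π (F c)) ∈ Metric.ball ((0 : E), σ₁) ε₂ ∧ G₁ (T^[n] (π (F c))) = 0)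 ∨ (∃ n : ℕ, T^[n] (π (F c)) ∈ Metric.ball ((0 : E), σ₂) ε₂ ∧ G₂ (T^[n] (π (F c))) = 0)) → ∀ 𝒟 : Literature.Geometry.Lorentzian.VacuumCauchyDevelopment (F c), 𝒟.IsMaximal → ¬ Summit.FinalStateConjecture.FinalStateConjecture.Theorems.ClusterCompleteness.SettlesT2 𝒟) → Summit.FinalStateConjecture.FinalStateConjecture.Theses.LaminatedThreshold.LaminatedThreshold := by
  rintro ⟨X, i₁, i₂, i₃, i₄, i₅, i₆, dstar, E, j₁, j₂, j₃, T, S, μ, r₀, π, hadm, hT0, hr₀, hT1, hTA, hS,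
    hμ, haxis, hπ0, hcont, hseed⟩
  -- not settled in any MGHD ⇒ exceptional (pure logic: `Good D` = MGHD exists ∧ every MGHD settles-T2)
  have key : ∀ D : InitialDataSet (𝓡 3) X,
      (∀ 𝒟 : VacuumCauchyDevelopment D, 𝒟.IsMaximal → ¬ SettlesT2 𝒟) →
      ¬ ((∃ 𝒟 : VacuumCauchyDevelopment D, 𝒟.IsMaximal) ∧ ∀ 𝒟 : VacuumCauchyDevelopment D, 𝒟.IsMaximal →
          Summit.FinalStateConjecture.HasCompleteNullInfinity 𝒟.toCauchyDevelopment ∧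
            ∃ (O : Set 𝒟.carrier) (d : FinalStateDecomposition 𝒟.toSpacetime O 2),
              (∀ i, Kerr.IsSubextremal (d.mass i) (d.spin i)) ∧
                O = Summit.FinalStateConjecture.exteriorOf 𝒟.toCauchyDevelopment d.charted ∧
                  Summit.FinalStateConjecture.RaysStayInClosure 𝒟.toCauchyDevelopment O ∧
                    Summit.FinalStateConjecture.HasExhaustiveCharts d ∧
                      Summit.FinalStateConjecture.IsFutureOriented d) := by
    rintro D hns ⟨⟨𝒟, h𝒟⟩, hall⟩
    exact hns 𝒟 h𝒟 (hall 𝒟 h𝒟)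
  -- the adapted comb lemma (landed) at this carrier: its radius `r₁`
  obtain ⟨r₁, hr₁, hcomb⟩ := Comb.comb_lemma_adapted E T S μ r₀ hT0 hr₀ hT1 hTA hS hμ haxis
  -- seeds on both sides at scale `r₁`, with the not-settled dictionary
  obtain ⟨σ₁, σ₂, ε₂, G₁, G₂, hε₂, hseeds, hdict⟩ := hseed r₁ hr₁
  -- the comb chart
  obtain ⟨ρ, hρ, Φ, K, hΦ0, hK0, hacc, hΦc, hsat⟩ := hcomb σ₁ σ₂ G₁ G₂ hseeds ε₂ hε₂
  -- the family clause, with "no MGHD settles" as conclusion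
  have hfam : ∀ F : EuclideanSpace ℝ (Fin 1) → InitialDataSet (𝓡 3) X, InitialDataSet.IsSmoothDataFamily 1 F →
      F 0 = dstar → (∀ c, F c ∈ admissibleVacuumData X) →
      (∃ C : Set X, IsCompact C ∧ ∀ c, ∀ x ∉ C, (F c).h.inner x = dstar.h.inner x ∧ (F c).k x = dstar.k x) →
      ∃ δ : ℝ, 0 < δ ∧ ContinuousOn (fun c ↦ Φ (π (F c))) (Metric.ball 0 δ) ∧
        ∀ c ∈ Metric.ball (0 : EuclideanSpace ℝ (Fin 1)) δ, Φ (π (F c)) ∈ K →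
          ∀ 𝒟 : VacuumCauchyDevelopment (F c), 𝒟.IsMaximal → ¬ SettlesT2 𝒟 := by
    intro F hF h0 hFadm hCpt
    obtain ⟨δ₁, hδ₁, hπc⟩ := hcont F hF h0 hFadm hCpt
    obtain ⟨δ₂, hδ₂, hnk⟩ := hdict F hF h0 hFadm hCpt
    -- `π ∘ F` is continuous at `0` and `π (F 0) = 0`, so small members are read inside `ball 0 ρ`
    have hat : ContinuousAt (fun c ↦ π (F c)) 0 :=
      (hπc 0 (Metric.mem_ball_self hδ₁)).continuousAt (Metric.ball_mem_nhds 0 hδ₁)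
    have h00 : π (F 0) = 0 := by rw [h0, hπ0]
    have hpre : (fun c ↦ π (F c)) ⁻¹' Metric.ball (0 : E × ℝ) ρ ∈ 𝓝 (0 : EuclideanSpace ℝ (Fin 1)) := by
      apply hat.preimage_mem_nhds
      rw [h00]
      exact Metric.ball_mem_nhds 0 hρ
    obtain ⟨δ₃, hδ₃, hball⟩ := Metric.mem_nhds_iff.1 hpre
    refine ⟨min δ₁ (min δ₂ δ₃), by positivity, ?_, ?_⟩
    · have hsub₁ : Metric.ball (0 : EuclideanSpace ℝ (Fin 1)) (min δ₁ (min δ₂ δ₃)) ⊆ Metric.ball 0 δ₁ :=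
        Metric.ball_subset_ball (min_le_left _ _)
      have hsub₃ : Metric.ball (0 : EuclideanSpace ℝ (Fin 1)) (min δ₁ (min δ₂ δ₃)) ⊆ Metric.ball 0 δ₃ :=
        (Metric.ball_subset_ball (min_le_right _ _)).trans (Metric.ball_subset_ball (min_le_right _ _))
      have hmaps : Set.MapsTo (fun c ↦ π (F c)) (Metric.ball (0 : EuclideanSpace ℝ (Fin 1)) (min δ₁ (min δ₂ δ₃)))
          (Metric.ball (0 : E × ℝ) ρ) := fun c hc ↦ hball (hsub₃ hc)
      exact hΦc.comp (hπc.mono hsub₁) hmaps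
    · intro c hc hK
      have hc₂ : c ∈ Metric.ball (0 : EuclideanSpace ℝ (Fin 1)) δ₂ :=
        (Metric.ball_subset_ball ((min_le_right _ _).trans (min_le_left _ _))) hc
      have hc₃ : c ∈ Metric.ball (0 : EuclideanSpace ℝ (Fin 1)) δ₃ :=
        (Metric.ball_subset_ball ((min_le_right _ _).trans (min_le_right _ _))) hc
      have hρc : π (F c) ∈ Metric.ball (0 : E × ℝ) ρ := hball hc₃
      exact hnk c hc₂ (hsat (π (F c)) hρc hK)
  refine ⟨X, i₁, i₂, i₃, i₄, i₅, i₆, dstar, fun D ↦ Φ (π D), K, hadm, ?_, ?_, ?_, ?_⟩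
  · -- `d⋆` is exceptional: saturation along the constant family through `d⋆`
    obtain ⟨δ, hδ, -, hns⟩ := hfam (fun _ ↦ dstar) (InitialDataSet.isSmoothDataFamily_const 1 dstar)
      rfl (fun _ ↦ hadm) ⟨∅, isCompact_empty, fun _ _ _ ↦ ⟨rfl, rfl⟩⟩
    have hmem : Φ (π dstar) ∈ K := by rw [hπ0, hΦ0]; exact hK0
    exact key dstar (hns 0 (Metric.mem_ball_self hδ) hmem)
  · -- `Φ d⋆ ∈ K`
    show Φ (π dstar) ∈ K
    rw [hπ0, hΦ0]; exact hK0
  · -- two-sided accumulation, transported along `Φ (π d⋆) = 0`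
    intro ε hε
    show (K ∩ Set.Ioo (Φ (π dstar) - ε) (Φ (π dstar))).Nonempty ∧
      (K ∩ Set.Ioo (Φ (π dstar)) (Φ (π dstar) + ε)).Nonempty
    rw [hπ0, hΦ0]
    exact hacc ε hε
  · -- the family clause: "no MGHD settles" converted into exceptionality
    intro F hF h0 hFadm hCpt
    obtain ⟨δ, hδ, hc, hns⟩ := hfam F hF h0 hFadm hCpt
    exact ⟨δ, hδ, hc, fun c hcδ hcK ↦ key (F c) (hns c hcδ hcK)⟩

/-- **Crux A from ONE stub: the adapted vacuum comb carrier with the SOJOURN dictionary** — the same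
carrier, its nakedness dictionary now concluding that every maximal vacuum development of a coded member
has INCOMPLETE future null infinity in Christodoulou's intrinsic (sojourn) sense,
`¬ Summit.FinalStateConjecture.HasCompleteNullInfinity 𝒟.toCauchyDevelopment` (the form in which "a naked
singularity forms" enters the summit statement; the sojourn rendering fails on naked-singularity MGHDs by
design). Immediate from `laminatedThreshold_of_notSettledCarrier`, since settled-T2 begins with complete
`𝓘⁺`. [cite: GrebogiEtAl1983] [cite: McdonaldEtAl1985] -/
theorem laminatedThreshold_of_sojournCarrier : (∃ (X : Type) (_ : TopologicalSpace X) (_ : ChartedSpace Literature.Geometry.Lorentzian.E3 X) (_ : IsManifold (𝓡 3) ((⊤ : ℕ∞) : WithTop ℕ∞) X) (_ : T2Space X) (_ : SecondCountableTopology X) (_ : ConnectedSpace X) (dstar : Literature.Geometry.Lorentzian.InitialDataSet (𝓡 3) X) (E : Type) (_ : NormedAddCommGroup E) (_ : NormedSpace ℝ E) (_ : CompleteSpace E) (T : E × ℝ → E × ℝ) (S : E →L[ℝ] E) (μ r₀ : ℝ) (π : Literature.Geometry.Lorentzian.InitialDataSet (𝓡 3) X → E × ℝ), dstar ∈ Literature.Geometry.Lorentzian.admissibleVacuumData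 X ∧ T 0 = 0 ∧ 0 < r₀ ∧ ContDiffOn ℝ 1 T (Metric.ball 0 r₀) ∧ HasFDerivAt T ((S.comp (ContinuousLinearMap.fst ℝ E ℝ)).prod (μ • ContinuousLinearMap.snd ℝ E ℝ)) 0 ∧ ‖S‖ < 1 ∧ 1 < μ ∧ (∀ t : ℝ, |t| < r₀ → (T ((0 : E), t)).1 = 0) ∧ π dstar = 0 ∧ (∀ F : EuclideanSpace ℝ (Fin 1) → Literature.Geometry.Lorentzian.InitialDataSet (𝓡 3) X, Literature.Geometry.Lorentzian.InitialDataSet.IsSmoothDataFamily 1 F → F 0 = dstar → (∀ c, F c ∈ Literature.Geometry.Lorentzian.admissibleVacuumData X) → (∃ C : Set X, IsCompact C ∧ ∀ c, ∀ x ∉ C, (F c).h.inner x = dstar.h.inner x ∧ (F c).k x = dstar.k x) → ∃ δ : ℝ, 0 < δ ∧ ContinuousOn (fun c ↦ π (F c)) (Metric.ball 0 δ)) ∧ ∀ r : ℝ, 0 < r → ∃ (σ₁ σ₂ ε₂ : ℝ) (G₁ G₂ : E × ℝ → ℝ), 0 < ε₂ ∧ (0 < σ₁ ∧ σ₁ <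 r ∧ -r < σ₂ ∧ σ₂ < 0 ∧ (∃ r' : ℝ, 0 < r' ∧ ContDiffOn ℝ 1 G₁ (Metric.ball ((0 : E), σ₁) r') ∧ ContDiffOn ℝ 1 G₂ (Metric.ball ((0 : E), σ₂) r')) ∧ G₁ ((0 : E), σ₁) = 0 ∧ fderiv ℝ G₁ ((0 : E), σ₁) ((0 : E), (1 : ℝ)) ≠ 0 ∧ G₂ ((0 : E), σ₂) = 0 ∧ fderiv ℝ G₂ ((0 : E), σ₂) ((0 : E), (1 : ℝ)) ≠ 0) ∧ ∀ F : EuclideanSpace ℝ (Fin 1) → Literature.Geometry.Lorentzian.InitialDataSet (𝓡 3) X, Literature.Geometry.Lorentzian.InitialDataSet.IsSmoothDataFamily 1 F → F 0 = dstar → (∀ c, F c ∈ Literature.Geometry.Lorentzian.admissibleVacuumData X) → (∃ C : Set X, IsCompact C ∧ ∀ c, ∀ x ∉ C, (F c).h.inner x = dstar.h.inner x ∧ (F c).k x = dstar.k x) → ∃ δ : ℝ, 0 < δ ∧ ∀ c ∈ Metric.ball (0 : EuclideanSpace ℝ (Fin 1)) δ, ((∀ n : ℕ, T^[n] (π (F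 c)) ∈ Metric.ball (0 : E × ℝ) ε₂) ∨ (∃ n : ℕ, T^[n] (π (F c)) ∈ Metric.ball ((0 : E), σ₁) ε₂ ∧ G₁ (T^[n] (π (F c))) = 0) ∨ (∃ n : ℕ, T^[n] (π (F c)) ∈ Metric.ball ((0 : E), σ₂) ε₂ ∧ G₂ (T^[n] (π (F c))) = 0)) → ∀ 𝒟 : Literature.Geometry.Lorentzian.VacuumCauchyDevelopment (F c), 𝒟.IsMaximal → ¬ Summit.FinalStateConjecture.HasCompleteNullInfinity 𝒟.toCauchyDevelopment) → Summit.FinalStateConjecture.FinalStateConjecture.Theses.LaminatedThreshold.LaminatedThreshold := by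
  rintro ⟨X, i₁, i₂, i₃, i₄, i₅, i₆, dstar, E, j₁, j₂, j₃, T, S, μ, r₀, π, hadm, hT0, hr₀, hT1, hTA, hS,
    hμ, haxis, hπ0, hcont, hseed⟩
  refine laminatedThreshold_of_notSettledCarrier ⟨X, i₁, i₂, i₃, i₄, i₅, i₆, dstar, E, j₁, j₂, j₃, T, S,
    μ, r₀, π, hadm, hT0, hr₀, hT1, hTA, hS, hμ, haxis, hπ0, hcont, fun r hr ↦ ?_⟩
  obtain ⟨σ₁, σ₂, ε₂, G₁, G₂, hε₂, hseeds, hdict⟩ := hseed r hr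
  refine ⟨σ₁, σ₂, ε₂, G₁, G₂, hε₂, hseeds, fun F hF h0 hFadm hCpt ↦ ?_⟩
  obtain ⟨δ, hδ, hinc⟩ := hdict F hF h0 hFadm hCpt
  exact ⟨δ, hδ, fun c hc horb 𝒟 h𝒟 hsettled ↦ hinc c hc horb 𝒟 h𝒟 hsettled.1⟩

end Summit.FinalStateConjecture.FinalStateConjecture.Theorems.LaminatedThreshold

end
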